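import Literature.NumberTheory.LFunctions.SuzukiCanonicalSystemKernelProofs
import Literature.NumberTheory.LFunctions.WeilResolventVector
import Literature.NumberTheory.LFunctions.ZetaArgVariation
import Literature.NumberTheory.LFunctions.ZetaZerosProofs
import Literature.NumberTheory.LFunctions.RiemannXiProofs
import Literature.Analysis.FunctionSpaces.PlancherelL1L2
import Mathlib.Analysis.Complex.JensenFormula
import HarnessLib

/-!
# Suzuki 2021, Lemma 4.4 (the uncertainty lemma for `K_ζ^{ω,ν}`): discharge of `Suzuki2021_lemma44`

LINE 1 — LABEL: RH-FREE (a support/uniqueness statement about one explicit integral kernel; no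
hypothesis and no conclusion about the location of the zeros of `ζ`). FRAMING (cell rh-crit,
D-0074): corpus theorems are RH-FREE literature; nothing here is worded as progress toward RH.
bears_on: B-C/B-P (LADDER-RH COLUMN 6 DBR — it is the RH-free input of [Su21] Prop. 4.4 ii)).
WHAT THIS IS NOT: not Prop. 4.4 (which needs the isometry of Lemma 3.2 under `E ∈ HB̄`), not a
criterion, not a route; nothing here bears on the truth of RH.

M. Suzuki, *Hamiltonians arising from L-functions in the Selberg class*, J. Funct. Anal. 281 (2021)
109116 = arXiv:1606.05726 [Suzuki2021Hamiltonians], Lemma 4.4 (p. 22 of the arXiv version), for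
`L = ζ`: «Let `t ≥ 0`. Suppose that `(ω,ν)` satisfies (2.8). Then the support of `𝖪_L^{ω,ν}𝖯_t f`
is not compact for every `f ∈ L²(ℝ)` unless `𝖪_L^{ω,ν}𝖯_t f = 0`.» The tree states it as the
named fact `Literature.NumberTheory.LFunctions.Suzuki2021_lemma44` (`SuzukiCanonicalSystem.lean`)
for `f` living on `(−t,t)` and the spectral kernel `suzukiKernel ω ν` ((2.6), `νω > 1`); this file
proves `Suzuki2021_lemma44_holds : Suzuki2021_lemma44`.

## The printed proof and how it is followed

Printed (Lemma 4.3 + Lemma 4.4): if `h = 𝖪𝖯_t f ≠ 0` had compact support, `𝖥h` would be entire of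
exponential type (Paley–Wiener); `𝖥h(z) = Θ(z)·𝖥𝖯_t f(−z)` (Lemma 3.2); writing
`Θ = (ξ(s−ω)/ξ(s+ω))^ν = (f₂^ω/f₁^ω)^ν` with coprime entire `f₁^ω, f₂^ω` (Lemma 4.3, a Weierstrass
product over the zeros `ρ` with `ρ + 2ω` again a zero), the zeros of the denominator which are not
killed by the numerator must be killed by `𝖥𝖯_t f(−z)`; there are `≍ T log T` of them up to height
`T` (Lemma 4.3, from `N(T) ∼ (1/π) T log T` and the fact that the zeros lie in the critical strip),
whereas an entire function of exponential type has `O(T)` zeros in the disc of radius `T` (Jensen)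
— contradiction.

Followed here step for step, with ONE declared deviation: Lemma 4.3's Weierstrass product
`f₀^ω` is replaced by its content, an ORDER COUNT. From the entire identity
`H(z)·ξ(½+ω−iz)^ν = ξ(½−ω−iz)^ν·G(z)` (`H = 𝖥h`, `G(z) = ∫_{(−t,t)} f(y)e^{−izy}dy`) one reads
off at `z(ρ′) = i(ρ′−½−ω)` that `G` vanishes to order `≥ m(ρ′) − m(ρ′−2ω)` (`m` = multiplicity as a
zero of `ξ`), and the elementary CHAIN LEMMA `Σ_{0<Im ρ′≤T} (m(ρ′) ∸ m(ρ′−2ω)) ≥ N(T)/(⌈1/(2ω)⌉+1)`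
(telescoping along `ρ′, ρ′−2ω, ρ′−4ω, …`, which leaves the critical strip after `⌈1/(2ω)⌉` steps —
«it is impossible, because all zeros of `ξ_L(s)` must lie in the critical strip», proof of
Lemma 4.3) supplies the `≫ N(T)` deficient zeros. Paley–Wiener (easy direction) is the tree's
`hasDerivAt_weilMellin_of_ae_eq_zero`; the Fourier–Laplace identity is Fubini over the tree's
(4.9) `suzuki2021_prop41_fourier`; Jensen is Mathlib's `AnalyticOnNhd.sum_divisor_le`;
`N(T)/T → ∞` is the tree's Riemann–von Mangoldt theorem `riemann_von_mangoldt_holds`; `G ≡ 0 ⟹ f = 0`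
a.e. is Plancherel on `L¹ ∩ L²` (`Literature.Analysis.FunctionSpaces.integral_norm_sq_fourierIntegral_eq`).
As Suzuki remarks at the end of the proof, no `HB̄` hypothesis is used.

## Main result

* `Literature.NumberTheory.LFunctions.Suzuki2021_lemma44_holds : Suzuki2021_lemma44`.

Reusable on the way (namespace `SuzukiUncertainty`): `norm_weilMellin_le_of_window` (exponential
type of window transforms), `sum_divisor_le_of_expType` (Jensen count for entire functions of
exponential type), `chain_sum_le` (the chain lemma), `zetaZeroCount_le_mul_sum_deficiency`
(`N(T) ≤ (k+1)·Σ deficiencies`), `integral_kernelImage_mul_cexp` (the Fourier–Laplace identity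
`∫ (𝖪𝖯_t f)(x) e^{izx} dx = Θ(z) ∫ f(y) e^{−izy} dy` on `Im z > ½ + ω`).

## References

* [Suzuki2021Hamiltonians] M. Suzuki, J. Funct. Anal. 281 (2021) 109116 = arXiv:1606.05726, §4.3:
  Lemma 4.3 (p. 21–22), Lemma 4.4 (p. 22); Lemma 3.2; eq. (2.6), (2.8), (4.9).
* [Levin1996] B. Ya. Levin, *Lectures on entire functions*, AMS 1996, Lecture 2 (Jensen) — the `[Le96]`
  of the printed proof.
* [Titchmarsh1986] E. C. Titchmarsh, *The Theory of the Riemann Zeta-Function*, 2nd ed., Thm. 9.4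
  (Riemann–von Mangoldt), §2.12 (zeros of `ξ`).
-/

noncomputable section

open Complex MeasureTheory Filter Topology Set Metric
open scoped Real FourierTransform

namespace Literature.NumberTheory.LFunctions

namespace SuzukiUncertainty

/-! ## §1 Window transforms are entire of exponential type (Paley–Wiener, easy direction) -/

/-- `weilMellin u (½ + w) = ∫ u(x) e^{wx} dx`. [folklore] -/
private theorem weilMellin_half_add (u : ℝ → ℂ) (w : ℂ) :
    weilMellin u (1 / 2 + w) = ∫ x : ℝ, u x * cexp (w * x) := by
  unfold weilMellin
  congr 1 with x
  congr 2
  ring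

/-- The transform `s ↦ ∫ u(x)e^{(s−½)x}dx` of a function integrable on the window `[−a,a]` and a.e.
zero off it is entire. [cite: Suzuki2021Hamiltonians, proof of Lemma 4.4 («entire function of exponential type by the Paley-Wiener theorem»)] -/
theorem differentiable_weilMellin_of_window {a : ℝ} {u : ℝ → ℂ} (hint : IntegrableOn u (Icc (-a) a))
    (hae : ∀ᵐ x : ℝ, x ∉ Icc (-a) a → u x = 0) : Differentiable ℂ (weilMellin u) :=
  fun s ↦ (hasDerivAt_weilMellin_of_ae_eq_zero hint hae s).differentiableAt

/-- Exponential type of a window transform: `‖∫ u(x)e^{(s−½)x}dx‖ ≤ e^{a‖s−½‖} ∫‖u‖` for `u`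
integrable and living on `[−a,a]`. [cite: Suzuki2021Hamiltonians, proof of Lemma 4.4 (Paley–Wiener)] -/
theorem norm_weilMellin_le_of_window {a : ℝ} {u : ℝ → ℂ} (hint : Integrable u)
    (hae : ∀ᵐ x : ℝ, x ∉ Icc (-a) a → u x = 0) (s : ℂ) :
    ‖weilMellin u s‖ ≤ Real.exp (a * ‖s - 1 / 2‖) * ∫ x : ℝ, ‖u x‖ := by
  unfold weilMellin
  have hF : Integrable (fun x : ℝ ↦ u x * cexp ((s - 1 / 2) * x)) :=
    integrable_mul_continuous_of_ae_eq_zero hint.integrableOn hae (by fun_prop)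
  calc ‖∫ x : ℝ, u x * cexp ((s - 1 / 2) * x)‖
      ≤ ∫ x : ℝ, ‖u x * cexp ((s - 1 / 2) * x)‖ := norm_integral_le_integral_norm _
    _ ≤ ∫ x : ℝ, Real.exp (a * ‖s - 1 / 2‖) * ‖u x‖ := by
        refine integral_mono_ae hF.norm (hint.norm.const_mul _) ?_
        filter_upwards [hae] with x hx
        by_cases hxm : x ∈ Icc (-a) a
        · rw [norm_mul, Complex.norm_exp, mul_comm]
          refine mul_le_mul_of_nonneg_right (Real.exp_le_exp.2 ?_) (norm_nonneg _)
          have hre : ((s - 1 / 2) * (x : ℂ)).re = (s - 1 / 2).re * x := by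
            simp [mul_re]
          rw [hre]
          have hxa : |x| ≤ a := abs_le.2 ⟨hxm.1, hxm.2⟩
          calc (s - 1 / 2).re * x ≤ |(s - 1 / 2).re * x| := le_abs_self _
            _ = |(s - 1 / 2).re| * |x| := abs_mul _ _
            _ ≤ ‖s - 1 / 2‖ * a := mul_le_mul (abs_re_le_norm _) hxa (abs_nonneg _) (norm_nonneg _)
            _ = a * ‖s - 1 / 2‖ := mul_comm _ _
        · show ‖u x * cexp ((s - 1 / 2) * x)‖ ≤ Real.exp (a * ‖s - 1 / 2‖) * ‖u x‖
          rw [hx hxm]; simp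
    _ = Real.exp (a * ‖s - 1 / 2‖) * ∫ x : ℝ, ‖u x‖ := integral_const_mul _ _

/-! ## §2 Jensen: entire functions of exponential type have `O(r)` zeros in discs of radius `r` -/

/-- **Jensen's bound for entire functions of exponential type** (the `[Le96]` step of the printed
proof): if `G` is entire with `‖G(z)‖ ≤ A e^{B‖z‖}` (`A ≥ 1`, `B ≥ 0`) and `G(c) ≠ 0`, then the number
of zeros of `G` in the closed disc `B̄(c,r)`, counted with multiplicity (Mathlib's divisor), is at most
`(log A + B(‖c‖+2r) − log‖G(c)‖)/log 2`. [cite: Levin1996, Lecture 2 (Jensen); Suzuki2021Hamiltonians, proof of Lemma 4.4] -/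
theorem sum_divisor_le_of_expType {G : ℂ → ℂ} (hG : Differentiable ℂ G) {A B : ℝ} (hA : 1 ≤ A)
    (hB : 0 ≤ B) (hbound : ∀ z, ‖G z‖ ≤ A * Real.exp (B * ‖z‖)) {c : ℂ} (hc : G c ≠ 0) {r : ℝ}
    (hr : 0 < r) :
    ((∑ᶠ u, MeromorphicOn.divisor G (closedBall c r) u : ℤ) : ℝ) ≤
      (Real.log A + B * (‖c‖ + 2 * r) - Real.log ‖G c‖) / Real.log 2 := by
  set M : ℝ := A * Real.exp (B * (‖c‖ + 2 * r)) with hM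
  have hM1 : 1 ≤ M := by
    rw [hM]
    have : 1 ≤ Real.exp (B * (‖c‖ + 2 * r)) := Real.one_le_exp (by positivity)
    nlinarith
  have hGa : AnalyticOnNhd ℂ G (closedBall c |2 * r|) := fun z _ ↦ hG.analyticAt z
  have J := AnalyticOnNhd.sum_divisor_le (f := G) (c := c) (r := r) (R := 2 * r) (M := M)
    (by rwa [abs_of_pos hr]) (by rw [abs_of_pos hr, abs_of_pos (by linarith)]; linarith) hM1 hGa hc
    (by
      intro z hz
      rw [abs_of_pos (by linarith : (0:ℝ) < 2 * r)] at hz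
      refine (hbound z).trans ?_
      rw [hM]
      refine mul_le_mul_of_nonneg_left (Real.exp_le_exp.2 (mul_le_mul_of_nonneg_left ?_ hB))
        (by linarith)
      have h1 : ‖z‖ ≤ ‖z - c‖ + ‖c‖ := by
        calc ‖z‖ = ‖(z - c) + c‖ := by ring_nf
          _ ≤ ‖z - c‖ + ‖c‖ := norm_add_le _ _
      have h2 : ‖z - c‖ = 2 * r := by
        rw [mem_sphere, dist_eq_norm] at hz; exact hz
      linarith)
  rw [abs_of_pos hr] at J
  have hlog : Real.log (M / ‖G c‖) = Real.log A + B * (‖c‖ + 2 * r) - Real.log ‖G c‖ := by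
    rw [Real.log_div (by positivity) (norm_ne_zero_iff.2 hc), hM,
      Real.log_mul (by positivity) (Real.exp_pos _).ne', Real.log_exp]
  have hlog2 : Real.log (2 * r / r) = Real.log 2 := by
    rw [mul_div_assoc, div_self hr.ne', mul_one]
  rw [hlog, hlog2] at J
  exact J

/-- In a disc, the divisor of an entire function dominates any prescribed multiplicities at finitely
many distinct points: if `G` vanishes at `z i` to order `≥ d i` (`i ∈ S`, `z` injective on `S`, all
`z i ∈ B̄(c,r)`), then `Σ_{i∈S} d i ≤ Σᶠ divisor` (the zero-counting function `n(r)` with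
multiplicities). [cite: Levin1996, Lecture 2 (Jensen's theorem; the counting function n(r))] -/
theorem sum_le_finsum_divisor {G : ℂ → ℂ} (hG : Differentiable ℂ G) {ι : Type*} (S : Finset ι)
    (z : ι → ℂ) (hz : Set.InjOn z S) (d : ι → ℕ) {c : ℂ} {r : ℝ}
    (hmem : ∀ i ∈ S, z i ∈ closedBall c r)
    (hord : ∀ i ∈ S, ((d i : ℕ) : ℕ∞) ≤ analyticOrderAt G (z i))
    (hfin : ∀ i ∈ S, analyticOrderAt G (z i) ≠ ⊤) :
    ((∑ i ∈ S, d i : ℕ) : ℤ) ≤ ∑ᶠ u, MeromorphicOn.divisor G (closedBall c r) u := by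
  classical
  set D : ℂ → ℤ := ⇑(MeromorphicOn.divisor G (closedBall c r)) with hD
  have hGa : AnalyticOnNhd ℂ G (closedBall c r) := fun w _ ↦ hG.analyticAt w
  have hDnonneg : ∀ u, 0 ≤ D u := by
    intro u
    by_cases hu : u ∈ closedBall c r
    · rw [hD, MeromorphicOn.AnalyticOnNhd.divisor_apply hGa hu]
      cases analyticOrderAt G u with
      | top => simp
      | coe m => simp
    · simp [hD, hu]
  have hDz : ∀ i ∈ S, (d i : ℤ) ≤ D (z i) := by
    intro i hi
    rw [hD, MeromorphicOn.AnalyticOnNhd.divisor_apply hGa (hmem i hi)]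
    obtain ⟨n, hn⟩ := ENat.ne_top_iff_exists.mp (hfin i hi)
    rw [← hn]
    have hle := hord i hi
    rw [← hn, ENat.coe_le_coe] at hle
    simp only [ENat.map_coe, WithTop.untop₀_coe]
    exact_mod_cast hle
  have hfinsupp : (Function.support D).Finite :=
    (MeromorphicOn.divisor G (closedBall c r)).finiteSupport (isCompact_closedBall c r)
  rw [finsum_eq_sum_of_support_subset D (s := hfinsupp.toFinset) (by simp)]
  calc ((∑ i ∈ S, d i : ℕ) : ℤ) = ∑ i ∈ S, (d i : ℤ) := by push_cast; rfl
    _ ≤ ∑ i ∈ S, D (z i) := Finset.sum_le_sum hDz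
    _ = ∑ u ∈ S.image z, D u := (Finset.sum_image hz).symm
    _ = ∑ u ∈ (S.image z).filter (fun u ↦ D u ≠ 0), D u := (Finset.sum_filter_ne_zero _).symm
    _ ≤ ∑ u ∈ hfinsupp.toFinset, D u := by
        refine Finset.sum_le_sum_of_subset_of_nonneg (fun u hu ↦ ?_) (fun u _ _ ↦ hDnonneg u)
        rw [Finset.mem_filter] at hu
        exact hfinsupp.mem_toFinset.2 hu.2

/-! ## §3 The chain lemma (content of [Su21] Lemma 4.3 for `L = ζ`) -/

/-- Telescoping along a chain: for `a : ℕ → ℕ` with `a (k+1) = 0`, `a 0 ≤ Σ_{i ≤ k} (a i ∸ a (i+1))`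
(applied to `a i = m(ρ − 2iω)`: «this process is continued repeatedly. However, it is impossible,
because all zeros of `ξ_L(s)` must lie in the critical strip»).
[cite: Suzuki2021Hamiltonians, proof of Lemma 4.3] -/
theorem chain_sum_le (a : ℕ → ℕ) : ∀ k : ℕ, a (k + 1) = 0 →
    a 0 ≤ ∑ i ∈ Finset.range (k + 1), (a i - a (i + 1)) := by
  have key : ∀ k : ℕ, a 0 ≤ (∑ i ∈ Finset.range (k + 1), (a i - a (i + 1))) + a (k + 1) := by
    intro k
    induction k with
    | zero => simp; omega
    | succ k ih =>
        rw [Finset.sum_range_succ]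
        have : a (k + 1) ≤ (a (k + 1) - a (k + 1 + 1)) + a (k + 1 + 1) := by omega
        omega
  intro k hk
  have := key k
  rw [hk, add_zero] at this
  exact this

/-- `ξ` is entire and not identically zero (`ξ(0) = ½`), so its order of vanishing at every point is
finite. [cite: Titchmarsh1986, §2.1 and §2.12] -/
theorem analyticOrderAt_riemannXi_ne_top (s : ℂ) : analyticOrderAt riemannXi s ≠ ⊤ := by
  intro htop
  have h0 : riemannXi 0 = 0 :=
    AnalyticOnNhd.eqOn_zero_of_preconnected_of_eventuallyEq_zero (f := riemannXi) (U := univ)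
      (fun z _ ↦ differentiable_riemannXi.analyticAt z) isPreconnected_univ (mem_univ s)
      (analyticOrderAt_eq_top.mp htop) (mem_univ 0)
  rw [riemannXi_zero] at h0
  norm_num at h0

/-- `m(s) := analyticOrderNatAt ξ s` vanishes off the open critical strip (the zeros of `ξ` are the
non-trivial zeros of `ζ`, `riemannXi_eq_zero_iff_holds`). [cite: Titchmarsh1986, §2.12] -/
theorem analyticOrderNatAt_riemannXi_eq_zero_of_not_strip {s : ℂ} (hs : s.re ≤ 0 ∨ 1 ≤ s.re) :
    analyticOrderNatAt riemannXi s = 0 := by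
  have hne : riemannXi s ≠ 0 := by
    intro h
    obtain ⟨-, h1, h2⟩ := (riemannXi_eq_zero_iff_holds s).1 h
    rcases hs with hs | hs <;> linarith
  rw [analyticOrderNatAt, (differentiable_riemannXi.analyticAt s).analyticOrderAt_eq_zero.2 hne]
  rfl

/-- In the critical strip the multiplicity `m(ρ)` of `ρ` as a zero of `ζ` (`riemannZetaZeroOrder`)
is its order as a zero of `ξ` (`ξ = ½s(s−1)Γ_ℝ(s)·ζ` with a non-vanishing analytic cofactor).
[cite: Titchmarsh1986, §2.12] -/
theorem riemannZetaZeroOrder_eq_analyticOrderNatAt_riemannXi {ρ : ℂ} (h0 : 0 < ρ.re) (h1 : ρ.re < 1) :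
    riemannZetaZeroOrder ρ = (analyticOrderNatAt riemannXi ρ : ℤ) := by
  have hρ0 : ρ ≠ 0 := fun h ↦ by simp [h] at h0
  have hρ1 : ρ ≠ 1 := fun h ↦ by simp [h] at h1
  -- the cofactor `u(s) = 2/(s(s−1)) · Γ_ℝ(s)⁻¹`
  set u : ℂ → ℂ := fun s ↦ 2 / (s * (s - 1)) * (Gammaℝ s)⁻¹ with hu
  have hu_an : AnalyticAt ℂ u ρ := by
    have h2 : AnalyticAt ℂ (fun s : ℂ ↦ 2 / (s * (s - 1))) ρ := by
      apply AnalyticAt.div analyticAt_const (by fun_prop)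
      exact mul_ne_zero hρ0 (sub_ne_zero.mpr hρ1)
    exact h2.mul (differentiable_Gammaℝ_inv.analyticAt ρ)
  have hu_ne : u ρ ≠ 0 := by
    simp only [u]
    refine mul_ne_zero (div_ne_zero two_ne_zero (mul_ne_zero hρ0 (sub_ne_zero.mpr hρ1))) ?_
    exact inv_ne_zero (Gammaℝ_ne_zero_of_re_pos h0)
  have hU : ∀ᶠ s in 𝓝 ρ, s ≠ 0 ∧ s ≠ 1 := (isOpen_ne.inter isOpen_ne).mem_nhds ⟨hρ0, hρ1⟩
  have heq : (riemannXi * u) =ᶠ[𝓝 ρ] riemannZeta := by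
    filter_upwards [hU] with s hs
    have hss : s * (s - 1) ≠ 0 := mul_ne_zero hs.1 (sub_ne_zero.mpr hs.2)
    have hc : s * (s - 1) / 2 * (2 / (s * (s - 1))) = 1 := by
      rw [div_mul_div_comm, mul_comm (s * (s - 1)) 2, div_self (mul_ne_zero two_ne_zero hss)]
    calc (riemannXi * u) s
        = (s * (s - 1) / 2 * (2 / (s * (s - 1)))) * (completedRiemannZeta s * (Gammaℝ s)⁻¹) := by
          rw [Pi.mul_apply, riemannXi_eq_mul_completedRiemannZeta hs.1 hs.2]; simp only [u]; ring
      _ = riemannZeta s := by rw [hc, one_mul, riemannZeta_def_of_ne_zero hs.1, div_eq_mul_inv]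
  have hord : analyticOrderAt riemannZeta ρ = analyticOrderAt riemannXi ρ := by
    rw [← analyticOrderAt_congr heq,
      analyticOrderAt_mul ((differentiable_riemannXi).analyticAt ρ) hu_an,
      (hu_an.analyticOrderAt_eq_zero).mpr hu_ne, add_zero]
  have hζa : AnalyticAt ℂ riemannZeta ρ := analyticOn_riemannZeta ρ hρ1
  obtain ⟨n, hn⟩ := ENat.ne_top_iff_exists.mp (analyticOrderAt_riemannXi_ne_top ρ)
  rw [riemannZetaZeroOrder, hζa.meromorphicOrderAt_eq, hord, ← hn, analyticOrderNatAt, ← hn]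
  simp

/-- The deficiency `d(s) = m(s) ∸ m(s−2ω)`: if it is non-zero then `s` is a non-trivial zero of `ζ`.
[cite: Suzuki2021Hamiltonians, proof of Lemma 4.3] -/
theorem mem_zetaZeroBox_of_deficiency_ne_zero {ω T : ℝ} {s : ℂ} (him : 0 < s.im) (himT : s.im ≤ T)
    (h : analyticOrderNatAt riemannXi s - analyticOrderNatAt riemannXi (s - 2 * (ω : ℂ)) ≠ 0) :
    s ∈ zetaZeroBox 0 T := by
  have hm : analyticOrderNatAt riemannXi s ≠ 0 := fun h0 ↦ by simp [h0] at h
  have hξ : riemannXi s = 0 := by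
    by_contra hne
    exact hm (by
      rw [analyticOrderNatAt, (differentiable_riemannXi.analyticAt s).analyticOrderAt_eq_zero.2 hne]
      rfl)
  obtain ⟨hζ, h0, h1⟩ := (riemannXi_eq_zero_iff_holds s).1 hξ
  exact ⟨hζ, h0.le, h1.le, him, himT⟩

/-- **The chain lemma** (the content of [Su21] Lemma 4.3 for `L = ζ`): for `ω > 0` and
`k = ⌈1/(2ω)⌉`, `N(T) ≤ (k+1) · Σ_{0 < Im ρ′ ≤ T} (m(ρ′) ∸ m(ρ′−2ω))` — the denominator zeros of
`Θ = (ξ(s−ω)/ξ(s+ω))^ν` that the numerator cannot kill number `≫ N(T)`, because the chains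
`ρ′, ρ′−2ω, ρ′−4ω, …` leave the critical strip after `k` steps. [cite: Suzuki2021Hamiltonians, Lemma 4.3 (proof)] -/
theorem zetaZeroCount_le_mul_sum_deficiency {ω : ℝ} (hω : 0 < ω) (T : ℝ) :
    zetaZeroCount T ≤ (⌈1 / (2 * ω)⌉₊ + 1) *
      ∑ ρ ∈ (zetaZeroBox_finite 0 T).toFinset,
        (analyticOrderNatAt riemannXi ρ - analyticOrderNatAt riemannXi (ρ - 2 * (ω : ℂ))) := by
  classical
  set k : ℕ := ⌈1 / (2 * ω)⌉₊ with hk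
  set B := (zetaZeroBox_finite 0 T).toFinset with hB
  set m : ℂ → ℕ := fun s ↦ analyticOrderNatAt riemannXi s with hm
  set d : ℂ → ℕ := fun s ↦ m s - m (s - 2 * (ω : ℂ)) with hd
  have hkω : 1 ≤ 2 * ω * k := by
    have h1 : 1 / (2 * ω) ≤ k := Nat.le_ceil _
    have h2 : 0 < 2 * ω := by positivity
    calc (1:ℝ) = 2 * ω * (1 / (2 * ω)) := by field_simp
      _ ≤ 2 * ω * k := mul_le_mul_of_nonneg_left h1 h2.le
  -- `N(T) = Σ_{ρ ∈ B} m ρ`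
  have hN : zetaZeroCount T = ∑ ρ ∈ B, m ρ := by
    unfold zetaZeroCount zetaZeroCountRe
    rw [finsum_mem_eq_finite_toFinset_sum _ (zetaZeroBox_finite 0 T)]
    have : ∑ ρ ∈ B, riemannZetaZeroOrder ρ = ((∑ ρ ∈ B, m ρ : ℕ) : ℤ) := by
      push_cast
      refine Finset.sum_congr rfl fun ρ hρ ↦ ?_
      have hρ' : ρ ∈ zetaZeroBox 0 T := (Set.Finite.mem_toFinset _).1 hρ
      have him : ρ.im ≠ 0 := ne_of_gt hρ'.2.2.2.1
      obtain ⟨h0, h1⟩ := re_mem_Ioo_of_riemannZeta_eq_zero_of_im_ne_zero hρ'.1 him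
      exact riemannZetaZeroOrder_eq_analyticOrderNatAt_riemannXi h0 h1
    rw [← hB, this, Int.toNat_natCast]
  -- telescoping along the chain `ρ, ρ−2ω, …, ρ−2(k+1)ω`
  have hchain : ∀ ρ ∈ B, m ρ ≤ ∑ i ∈ Finset.range (k + 1), d (ρ - 2 * (ω : ℂ) * i) := by
    intro ρ hρ
    have hρ' : ρ ∈ zetaZeroBox 0 T := (Set.Finite.mem_toFinset _).1 hρ
    have hre1 : ρ.re ≤ 1 := hρ'.2.2.1
    have key := chain_sum_le (fun i ↦ m (ρ - 2 * (ω : ℂ) * i)) k (by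
      show m (ρ - 2 * (ω : ℂ) * ((k + 1 : ℕ) : ℂ)) = 0
      apply analyticOrderNatAt_riemannXi_eq_zero_of_not_strip
      left
      have : (ρ - 2 * (ω : ℂ) * ((k + 1 : ℕ) : ℂ)).re = ρ.re - 2 * ω * (k + 1) := by
        simp [sub_re, mul_re]
      rw [this]
      nlinarith)
    simp only [Nat.cast_zero, mul_zero, sub_zero] at key
    refine key.trans (le_of_eq (Finset.sum_congr rfl fun i _ ↦ ?_))
    simp only [hd]
    congr 2
    push_cast
    ring
  -- each shifted sum is bounded by the unshifted one
  have hshift : ∀ i : ℕ, ∑ ρ ∈ B, d (ρ - 2 * (ω : ℂ) * i) ≤ ∑ ρ ∈ B, d ρ := by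
    intro i
    have hinj : Set.InjOn (fun ρ : ℂ ↦ ρ - 2 * (ω : ℂ) * i) B := fun x _ y _ hxy ↦ by
      simpa using hxy
    rw [← Finset.sum_image hinj, ← Finset.sum_filter_ne_zero]
    refine Finset.sum_le_sum_of_subset fun s hs ↦ ?_
    rw [Finset.mem_filter, Finset.mem_image] at hs
    obtain ⟨⟨ρ, hρ, rfl⟩, hne⟩ := hs
    have hρ' : ρ ∈ zetaZeroBox 0 T := (Set.Finite.mem_toFinset _).1 hρ
    refine (Set.Finite.mem_toFinset _).2 (mem_zetaZeroBox_of_deficiency_ne_zero ?_ ?_ hne)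
    · simpa [sub_im, mul_im] using hρ'.2.2.2.1
    · simpa [sub_im, mul_im] using hρ'.2.2.2.2
  calc zetaZeroCount T = ∑ ρ ∈ B, m ρ := hN
    _ ≤ ∑ ρ ∈ B, ∑ i ∈ Finset.range (k + 1), d (ρ - 2 * (ω : ℂ) * i) := Finset.sum_le_sum hchain
    _ = ∑ i ∈ Finset.range (k + 1), ∑ ρ ∈ B, d (ρ - 2 * (ω : ℂ) * i) := Finset.sum_comm
    _ ≤ ∑ _i ∈ Finset.range (k + 1), ∑ ρ ∈ B, d ρ := Finset.sum_le_sum fun i _ ↦ hshift i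
    _ = (k + 1) * ∑ ρ ∈ B, d ρ := by rw [Finset.sum_const, Finset.card_range, smul_eq_mul]

/-! ## §4 The order count at the denominator zeros (replacing Lemma 4.3's Weierstrass product) -/

/-- The point `z(ρ) = i(ρ − ½ − ω)` at which `ξ(½+ω−iz)` reads `ξ(ρ)` and `ξ(½−ω−iz)` reads
`ξ(ρ−2ω)`. [folklore] -/
private theorem half_add_sub_I_mul_zPoint (ω : ℝ) (ρ : ℂ) :
    1 / 2 + (ω : ℂ) - I * (I * (ρ - 1 / 2 - ω)) = ρ := by
  have : I * I = -1 := Complex.I_mul_I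
  linear_combination (-(ρ - 1 / 2 - ω)) * this

/-- Companion of the previous lemma for the numerator `ξ(½−ω−iz)`. [folklore] -/
private theorem half_sub_sub_I_mul_zPoint (ω : ℝ) (ρ : ℂ) :
    1 / 2 - (ω : ℂ) - I * (I * (ρ - 1 / 2 - ω)) = ρ - 2 * (ω : ℂ) := by
  have : I * I = -1 := Complex.I_mul_I
  linear_combination (-(ρ - 1 / 2 - ω)) * this

/-- Order of `z ↦ ξ(a − iz)` at `z₀` = order of `ξ` at `a − iz₀` (affine change of variable with
derivative `−i ≠ 0`). [folklore] -/
private theorem analyticOrderAt_riemannXi_comp_affine (a z₀ : ℂ) :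
    analyticOrderAt (fun z ↦ riemannXi (a - I * z)) z₀ = analyticOrderAt riemannXi (a - I * z₀) := by
  have h := analyticOrderAt_comp_of_deriv_ne_zero (f := riemannXi) (g := fun z : ℂ ↦ a - I * z)
    (z₀ := z₀) (by fun_prop) (by
      rw [show (fun z : ℂ ↦ a - I * z) = fun z ↦ a + (-I) * z by funext z; ring]
      rw [deriv_const_add, deriv_const_mul _ differentiableAt_id, deriv_id'']
      simp)
  exact h

/-- **The order count.** If `H, G` are entire, `G` has finite order everywhere, and
`H(z)·ξ(½+ω−iz)^ν = ξ(½−ω−iz)^ν·G(z)` identically, then at `z(ρ) = i(ρ−½−ω)` the function `G`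
vanishes to order at least `ν(m(ρ) − m(ρ−2ω)) ≥ m(ρ) ∸ m(ρ−2ω)` (`ν ≥ 1`): the zeros of the
denominator of `Θ` not killed by the numerator are killed by `G`.
[cite: Suzuki2021Hamiltonians, proof of Lemma 4.4 («which therefore must be killed by zeros of 𝖥𝖯_a f(−z)»)] -/
theorem deficiency_le_analyticOrderNatAt {ω : ℝ} {ν : ℕ} (hν : 1 ≤ ν) {H G : ℂ → ℂ}
    (hH : Differentiable ℂ H) (hG : Differentiable ℂ G) (hGfin : ∀ z, analyticOrderAt G z ≠ ⊤)
    (hPQ : ∀ z, H z * riemannXi (1 / 2 + ω - I * z) ^ ν = riemannXi (1 / 2 - ω - I * z) ^ ν * G z)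
    (ρ : ℂ) :
    ((analyticOrderNatAt riemannXi ρ - analyticOrderNatAt riemannXi (ρ - 2 * (ω : ℂ)) : ℕ) : ℕ∞) ≤
      analyticOrderAt G (I * (ρ - 1 / 2 - ω)) := by
  set z₀ : ℂ := I * (ρ - 1 / 2 - ω) with hz₀
  -- the two sides as functions
  have hfun : (H * (fun z ↦ riemannXi (1 / 2 + ω - I * z)) ^ ν) =
      ((fun z ↦ riemannXi (1 / 2 - ω - I * z)) ^ ν * G) := by
    funext z; simp only [Pi.mul_apply, Pi.pow_apply]; exact hPQ z
  have hHa : AnalyticAt ℂ H z₀ := hH.analyticAt z₀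
  have hGa : AnalyticAt ℂ G z₀ := hG.analyticAt z₀
  have hEp : AnalyticAt ℂ (fun z ↦ riemannXi (1 / 2 + ω - I * z)) z₀ := by
    exact (differentiable_riemannXi.comp (by fun_prop : Differentiable ℂ fun z : ℂ ↦ 1 / 2 + ω - I * z)).analyticAt z₀
  have hEm : AnalyticAt ℂ (fun z ↦ riemannXi (1 / 2 - ω - I * z)) z₀ := by
    exact (differentiable_riemannXi.comp (by fun_prop : Differentiable ℂ fun z : ℂ ↦ 1 / 2 - ω - I * z)).analyticAt z₀
  -- orders of the two `ξ`-factors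
  have hordp : analyticOrderAt (fun z ↦ riemannXi (1 / 2 + ω - I * z)) z₀ =
      (analyticOrderNatAt riemannXi ρ : ℕ∞) := by
    rw [analyticOrderAt_riemannXi_comp_affine, hz₀, half_add_sub_I_mul_zPoint, analyticOrderNatAt,
      ENat.coe_toNat (analyticOrderAt_riemannXi_ne_top ρ)]
  have hordm : analyticOrderAt (fun z ↦ riemannXi (1 / 2 - ω - I * z)) z₀ =
      (analyticOrderNatAt riemannXi (ρ - 2 * (ω : ℂ)) : ℕ∞) := by
    rw [analyticOrderAt_riemannXi_comp_affine, hz₀, half_sub_sub_I_mul_zPoint, analyticOrderNatAt,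
      ENat.coe_toNat (analyticOrderAt_riemannXi_ne_top _)]
  have hL : analyticOrderAt (H * (fun z ↦ riemannXi (1 / 2 + ω - I * z)) ^ ν) z₀ =
      analyticOrderAt H z₀ + ν * (analyticOrderNatAt riemannXi ρ : ℕ∞) := by
    rw [analyticOrderAt_mul hHa (hEp.pow ν), analyticOrderAt_pow hEp, hordp, nsmul_eq_mul]
  have hR : analyticOrderAt ((fun z ↦ riemannXi (1 / 2 - ω - I * z)) ^ ν * G) z₀ =
      ν * (analyticOrderNatAt riemannXi (ρ - 2 * (ω : ℂ)) : ℕ∞) + analyticOrderAt G z₀ := by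
    rw [analyticOrderAt_mul (hEm.pow ν) hGa, analyticOrderAt_pow hEm, hordm, nsmul_eq_mul]
  have heq : analyticOrderAt H z₀ + ν * (analyticOrderNatAt riemannXi ρ : ℕ∞) =
      ν * (analyticOrderNatAt riemannXi (ρ - 2 * (ω : ℂ)) : ℕ∞) + analyticOrderAt G z₀ := by
    rw [← hL, ← hR, hfun]
  -- read off the inequality in `ℕ`
  obtain ⟨b, hb⟩ := ENat.ne_top_iff_exists.mp (hGfin z₀)
  set m₁ := analyticOrderNatAt riemannXi ρ
  set m₂ := analyticOrderNatAt riemannXi (ρ - 2 * (ω : ℂ))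
  rw [← hb] at heq ⊢
  have hHfin : analyticOrderAt H z₀ ≠ ⊤ := by
    intro htop
    rw [htop, top_add] at heq
    have : (ν : ℕ∞) * (m₂ : ℕ∞) + (b : ℕ∞) ≠ ⊤ := by
      exact_mod_cast ENat.coe_ne_top (ν * m₂ + b)
    exact this heq.symm
  obtain ⟨a, ha⟩ := ENat.ne_top_iff_exists.mp hHfin
  rw [← ha] at heq
  have heq' : a + ν * m₁ = ν * m₂ + b := by exact_mod_cast heq
  have h1 : m₁ - m₂ ≤ ν * m₁ - ν * m₂ := by
    rw [← Nat.mul_sub]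
    exact Nat.le_mul_of_pos_left _ hν
  exact_mod_cast h1.trans (by omega)

/-! ## §5 The Fourier–Laplace identity `∫ (𝖪𝖯_t f)(x) e^{izx} dx = Θ(z)·∫ f(y)e^{−izy} dy` -/

/-- **Lemma 3.2's identity in the half-plane of absolute convergence** (Fubini over (4.9)): for a
kernel `K` with `x ↦ K(x)e^{izx}` integrable and `∫ K(x)e^{izx}dx = Θ(z)`, and `g ∈ L¹(ℝ)` vanishing
off `(−t,t)`, the image `h(x) = ∫ K(x+y) g(y) dy` satisfies `∫ h(x)e^{izx}dx = Θ(z)·∫ g(y)e^{−izy}dy`,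
the integrand `x ↦ h(x)e^{izx}` being integrable. [cite: Suzuki2021Hamiltonians, Lemma 3.2 and proof of Lemma 4.4] -/
theorem integral_kernelImage_mul_cexp {K : ℝ → ℂ} (hKc : Continuous K) {z Θz : ℂ}
    (hKi : Integrable fun x : ℝ ↦ K x * cexp (I * z * x))
    (hKΘ : ∫ x : ℝ, K x * cexp (I * z * x) = Θz) {g : ℝ → ℂ} {t : ℝ} (hg : Integrable g)
    (hgt : ∀ y, y ∉ Ioo (-t) t → g y = 0) :
    Integrable (fun x : ℝ ↦ (∫ y : ℝ, K (x + y) * g y) * cexp (I * z * x)) ∧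
      ∫ x : ℝ, (∫ y : ℝ, K (x + y) * g y) * cexp (I * z * x) =
        Θz * ∫ y : ℝ, g y * cexp (-(I * z * y)) := by
  -- the two-variable integrand
  set F : ℝ → ℝ → ℂ := fun x y ↦ K (x + y) * g y * cexp (I * z * x) with hF
  have hFxy : ∀ x y, F x y = (g y * cexp (-(I * z * y))) * (K (x + y) * cexp (I * z * (x + y))) := by
    intro x y
    simp only [hF]
    rw [show I * z * ((x : ℂ) + (y : ℂ)) = I * z * x + I * z * y by ring, Complex.exp_add]
    have : cexp (-(I * z * y)) * cexp (I * z * y) = 1 := by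
      rw [← Complex.exp_add]; simp
    linear_combination (-(g y * K (x + y) * cexp (I * z * x))) * this
  -- measurability on the product
  have hFm : AEStronglyMeasurable (Function.uncurry F) (volume.prod volume) := by
    have h1 : AEStronglyMeasurable (fun p : ℝ × ℝ ↦ K (p.1 + p.2)) (volume.prod volume) :=
      (hKc.comp (continuous_fst.add continuous_snd)).aestronglyMeasurable
    have h2 : AEStronglyMeasurable (fun p : ℝ × ℝ ↦ g p.2) (volume.prod volume) :=
      hg.aestronglyMeasurable.comp_snd
    have h3 : AEStronglyMeasurable (fun p : ℝ × ℝ ↦ cexp (I * z * (p.1 : ℝ))) (volume.prod volume) :=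
      (by fun_prop : Continuous fun p : ℝ × ℝ ↦ cexp (I * z * (p.1 : ℝ))).aestronglyMeasurable
    exact (h1.mul h2).mul h3
  -- the `x`-sections are translates of `K e^{iz·}` times a constant
  have hsec : ∀ y, Integrable (fun x ↦ F x y) := by
    intro y
    have htr : Integrable (fun x : ℝ ↦ K (x + y) * cexp (I * z * ((x + y : ℝ) : ℂ))) :=
      hKi.comp_add_right y
    have := htr.const_mul (g y * cexp (-(I * z * y)))
    refine this.congr (Eventually.of_forall fun x ↦ ?_)
    simp only [hFxy]
    push_cast
    ring_nf
  have hnormsec : ∀ y, ∫ x, ‖F x y‖ = ‖g y * cexp (-(I * z * y))‖ * ∫ x, ‖K x * cexp (I * z * x)‖ := by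
    intro y
    have e1 : (fun x ↦ ‖F x y‖) = fun x ↦ ‖g y * cexp (-(I * z * y))‖ *
        ‖K (x + y) * cexp (I * z * ((x + y : ℝ) : ℂ))‖ := by
      funext x; rw [hFxy, norm_mul]; push_cast; ring_nf
    rw [e1, integral_const_mul]
    congr 1
    exact integral_add_right_eq_self (fun x : ℝ ↦ ‖K x * cexp (I * z * (x : ℂ))‖) y
  have hInt : Integrable (Function.uncurry F) (volume.prod volume) := by
    rw [integrable_prod_iff' hFm]
    refine ⟨Eventually.of_forall hsec, ?_⟩
    simp only [Function.uncurry_apply_pair, hnormsec]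
    refine (Integrable.mul_const ?_ _)
    -- `y ↦ ‖g y e^{-izy}‖` is integrable: bounded exponential on the window, `g = 0` off it
    have hb : ∀ y, ‖g y * cexp (-(I * z * y))‖ ≤ ‖g y‖ * Real.exp (‖z‖ * |t|) := by
      intro y
      by_cases hy : y ∈ Ioo (-t) t
      · rw [norm_mul, Complex.norm_exp]
        refine mul_le_mul_of_nonneg_left (Real.exp_le_exp.2 ?_) (norm_nonneg _)
        have : (-(I * z * (y : ℂ))).re = z.im * y := by simp [mul_re]
        rw [this]
        have hy' : |y| ≤ |t| := by
          rw [abs_le]; constructor <;> cases abs_cases t <;> linarith [hy.1, hy.2]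
        calc z.im * y ≤ |z.im * y| := le_abs_self _
          _ = |z.im| * |y| := abs_mul _ _
          _ ≤ ‖z‖ * |t| := mul_le_mul (abs_im_le_norm z) hy' (abs_nonneg _) (norm_nonneg _)
      · rw [hgt y hy]; simp
    refine Integrable.mono' (hg.norm.mul_const (Real.exp (‖z‖ * |t|))) ?_
      (Eventually.of_forall fun y ↦ ?_)
    · exact ((hg.aestronglyMeasurable.mul (by fun_prop : Continuous fun y : ℝ ↦
        cexp (-(I * z * (y : ℂ)))).aestronglyMeasurable).norm)
    · rw [Real.norm_eq_abs, abs_norm]; exact hb y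
  -- Fubini
  have hswap := integral_integral_swap hInt
  -- inner `y`-integral is `h(x) e^{izx}`
  have hinner_y : ∀ x, ∫ y, F x y = (∫ y : ℝ, K (x + y) * g y) * cexp (I * z * x) := by
    intro x
    simp only [hF]
    exact integral_mul_const _ _
  -- inner `x`-integral is `g(y)e^{-izy} Θ(z)`
  have hinner_x : ∀ y, ∫ x, F x y = g y * cexp (-(I * z * y)) * Θz := by
    intro y
    have e1 : (fun x ↦ F x y) = fun x ↦ (g y * cexp (-(I * z * y))) *
        (K (x + y) * cexp (I * z * ((x + y : ℝ) : ℂ))) := by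
      funext x; rw [hFxy]; push_cast; ring_nf
    rw [e1, integral_const_mul]
    congr 1
    rw [← hKΘ]
    exact integral_add_right_eq_self (fun x : ℝ ↦ K x * cexp (I * z * (x : ℂ))) y
  simp_rw [hinner_y, hinner_x] at hswap
  refine ⟨?_, ?_⟩
  · have := hInt.integral_prod_left
    refine this.congr (Eventually.of_forall fun x ↦ ?_)
    simp only [Function.uncurry_apply_pair]
    exact hinner_y x
  · rw [hswap, integral_mul_const, mul_comm]

/-! ## §6 Two more inputs: `N(T)/T → ∞` and continuity of the image `𝖪𝖯_t f` -/

/-- The Riemann–von Mangoldt main term divided by `T` tends to `+∞`. [folklore] -/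
private theorem tendsto_vonMangoldtMain_div_atTop :
    Tendsto (fun T : ℝ ↦ (T / (2 * Real.pi) * Real.log (T / (2 * Real.pi)) - T / (2 * Real.pi)) / T)
      atTop atTop := by
  have h2π : 0 < 2 * Real.pi := by positivity
  have hlog : Tendsto (fun T : ℝ ↦ Real.log (T / (2 * Real.pi))) atTop atTop :=
    Real.tendsto_log_atTop.comp (tendsto_id.atTop_div_const h2π)
  have hmain : Tendsto (fun T : ℝ ↦ (Real.log (T / (2 * Real.pi)) - 1) / (2 * Real.pi)) atTop atTop :=
    (tendsto_atTop_add_const_right _ (-1) hlog).atTop_div_const h2π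
  refine hmain.congr' ?_
  filter_upwards [eventually_gt_atTop 0] with T hT
  field_simp

/-- **`N(T)/T → ∞`** from the tree's Riemann–von Mangoldt theorem `riemann_von_mangoldt_holds`
(`N(T) = (T/2π)log(T/2π) − T/2π + O(log T)`) — the «`N_L(T) ∼ (d_L/π) T log T`» input of the
printed Lemma 4.3. [cite: Titchmarsh1986, Thm. 9.4] -/
theorem tendsto_zetaZeroCount_div_atTop :
    Tendsto (fun T : ℝ ↦ (zetaZeroCount T : ℝ) / T) atTop atTop := by
  have h := riemann_von_mangoldt_holds
  have herr : Tendsto (fun T : ℝ ↦ ((zetaZeroCount T : ℝ) -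
      (T / (2 * Real.pi) * Real.log (T / (2 * Real.pi)) - T / (2 * Real.pi))) / T) atTop (𝓝 0) :=
    (h.trans_isLittleO Real.isLittleO_log_id_atTop).tendsto_div_nhds_zero
  have hsum := tendsto_atTop_add_right_of_le' atTop (-1 : ℝ) tendsto_vonMangoldtMain_div_atTop
    (herr.eventually (eventually_ge_nhds (by norm_num : (-1 : ℝ) < 0)))
  refine hsum.congr' ?_
  filter_upwards [eventually_gt_atTop 0] with T hT
  field_simp
  ring

/-- The image `x ↦ ∫_{(−t,t)} K(x+y) f(y) dy` of an integrable `f` under a continuous kernel is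
continuous (dominated convergence on bounded `x`-ranges). [folklore] -/
private theorem continuous_kernelImage {K : ℝ → ℝ} (hK : Continuous K) {t : ℝ} {f : ℝ → ℝ}
    (hf : Integrable f (volume.restrict (Ioo (-t) t))) :
    Continuous fun x ↦ ∫ y in Ioo (-t) t, K (x + y) * f y := by
  rw [continuous_iff_continuousAt]
  intro x₀
  obtain ⟨C, hC⟩ := (isCompact_Icc (a := x₀ - 1 - |t|) (b := x₀ + 1 + |t|)).exists_bound_of_continuousOn
    hK.continuousOn
  refine continuousAt_of_dominated (bound := fun y ↦ C * ‖f y‖) ?_ ?_ (hf.norm.const_mul C) ?_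
  · exact Eventually.of_forall fun x ↦
      ((hK.comp (continuous_const.add continuous_id)).aestronglyMeasurable.mul hf.aestronglyMeasurable)
  · filter_upwards [Metric.ball_mem_nhds x₀ one_pos] with x hx
    filter_upwards [ae_restrict_mem measurableSet_Ioo] with y hy
    rw [norm_mul]
    refine mul_le_mul_of_nonneg_right (hC _ ⟨?_, ?_⟩) (norm_nonneg _)
    · rw [Metric.mem_ball, Real.dist_eq] at hx
      have := (abs_lt.1 hx).1
      cases abs_cases t <;> linarith [hy.1, hy.2]
    · rw [Metric.mem_ball, Real.dist_eq] at hx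
      have := (abs_lt.1 hx).2
      cases abs_cases t <;> linarith [hy.1, hy.2]
  · exact Eventually.of_forall fun y ↦
      ((hK.comp (continuous_id.add continuous_const)).continuousAt.mul continuousAt_const)

end SuzukiUncertainty

/-! ## §7 The theorem -/

open SuzukiUncertainty in
/-- **[Su21] Lemma 4.4 for `L = ζ` — DISCHARGE of the named fact `Suzuki2021_lemma44`** (RH-free):
for `ω > 0`, `ν ≥ 1`, `νω > 1`, `t ≥ 0` and `f ∈ L²(−t,t)`, if `h(x) = ∫_{(−t,t)} K_ζ^{ω,ν}(x+y)f(y)dy`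
vanishes a.e. beyond some `R`, then `h = 0` (a.e.; in fact everywhere). Printed proof followed (see
the module docstring): Paley–Wiener for the compactly supported `h` and `f𝟙_{(−t,t)}`, the Fubini
identity `∫ h e^{izx} = Θ(z)·∫ f e^{−izy}` (Lemma 3.2 / (4.9)), clearing the denominator
`ξ(½+ω−iz)^ν`, the order count at its zeros (Lemma 4.3's content), Jensen's `O(T)` bound against
`N(T) ≫ T log T`, and finally Plancherel. [cite: Suzuki2021Hamiltonians, Lemma 4.4 (with Lemma 4.3, Lemma 3.2, eq. (4.9))] -/
theorem Suzuki2021_lemma44_holds : Suzuki2021_lemma44 := by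
  intro ω hω ν hν hνω t ht f hf hR
  obtain ⟨R, hR⟩ := hR
  set K : ℝ → ℝ := suzukiKernel ω ν with hKdef
  set μ : Measure ℝ := volume.restrict (Ioo (-t) t) with hμ
  set h : ℝ → ℝ := fun x ↦ ∫ y in Ioo (-t) t, K (x + y) * f y with hh
  show (fun x ↦ h x) =ᵐ[volume] 0
  haveI : IsFiniteMeasure μ := isFiniteMeasure_restrict.2 measure_Ioo_lt_top.ne
  have hf1 : Integrable f μ := hf.integrable one_le_two
  -- the test function `g = f 𝟙_{(−t,t)}` (complex-valued)
  set g : ℝ → ℂ := (Ioo (-t) t).indicator (fun y ↦ ((f y : ℝ) : ℂ)) with hg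
  have hg1 : Integrable g := by
    rw [hg, integrable_indicator_iff measurableSet_Ioo]
    exact hf1.ofReal
  have hg2 : MemLp g 2 volume := by
    rw [hg, memLp_indicator_iff_restrict measurableSet_Ioo]
    exact hf.ofReal
  have hgt : ∀ y, y ∉ Ioo (-t) t → g y = 0 := fun y hy ↦ Set.indicator_of_notMem hy _
  have hg_ae : ∀ᵐ y : ℝ, y ∉ Icc (-t) t → g y = 0 :=
    Eventually.of_forall fun y hy ↦ hgt y fun hy' ↦ hy (Ioo_subset_Icc_self hy')
  -- kernel facts
  have hK0 : ∀ x : ℝ, x < 0 → K x = 0 := fun x hx ↦ (suzuki2021_prop41_i hω hν hνω hx).1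
  have hKc : Continuous K := suzuki2021_prop41_iv hω ν hνω
  -- `h` vanishes to the left of `−t`, is continuous, and `(h x : ℂ) = ∫ K(x+y) g(y) dy`
  have hhneg : ∀ x : ℝ, x ≤ -t → h x = 0 := by
    intro x hx
    refine setIntegral_eq_zero_of_forall_eq_zero fun y hy ↦ ?_
    rw [hK0 _ (by linarith [hy.2]), zero_mul]
  have hcont : Continuous h := continuous_kernelImage hKc hf1
  have hhC : ∀ x : ℝ, (h x : ℂ) = ∫ y : ℝ, ((K (x + y) : ℝ) : ℂ) * g y := by
    intro x
    simp only [hh]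
    rw [← integral_complex_ofReal, ← integral_indicator measurableSet_Ioo]
    congr 1 with y
    by_cases hy : y ∈ Ioo (-t) t
    · simp [hg, hy]
    · simp [hg, hy]
  -- the window `[−a,a]` carrying `h`
  set a : ℝ := max t |R| + 1 with ha
  have hta : t < a := by have := le_max_left t |R|; linarith
  have hRa : R < a := by have := le_max_right t |R|; have := le_abs_self R; linarith
  set u : ℝ → ℂ := (Icc (-a) a).indicator (fun x ↦ ((h x : ℝ) : ℂ)) with hu
  have hu1 : Integrable u := by
    rw [hu, integrable_indicator_iff measurableSet_Icc]
    exact (continuous_ofReal.comp hcont).integrableOn_Icc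
  have hu_ae : ∀ᵐ x : ℝ, x ∉ Icc (-a) a → u x = 0 :=
    Eventually.of_forall fun x hx ↦ Set.indicator_of_notMem hx _
  have hhu : (fun x ↦ ((h x : ℝ) : ℂ)) =ᵐ[volume] u := by
    have hR' : ∀ᵐ x : ℝ, x ∈ Ioi R → h x = 0 := (ae_restrict_iff' measurableSet_Ioi).1 hR
    filter_upwards [hR'] with x hx
    by_cases hxm : x ∈ Icc (-a) a
    · simp [hu, hxm]
    · rw [hu, Set.indicator_of_notMem hxm]
      rw [mem_Icc, not_and_or, not_le, not_le] at hxm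
      rcases hxm with hlt | hgt'
      · rw [hhneg x (by linarith)]; simp
      · rw [hx (show x ∈ Ioi R by simpa using lt_trans hRa hgt')]; simp
  -- the two entire functions `G(z) = ∫ g(y)e^{−izy}dy`, `H(z) = ∫ h(x)e^{izx}dx`
  set G : ℂ → ℂ := fun z ↦ weilMellin g (1 / 2 + -(I * z)) with hGdef
  set H : ℂ → ℂ := fun z ↦ weilMellin u (1 / 2 + I * z) with hHdef
  have hGint : ∀ z, G z = ∫ y : ℝ, g y * cexp (-(I * z * y)) := by
    intro z; simp only [hGdef, weilMellin_half_add]; congr 1 with y; congr 1; ring_nf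
  have hHint : ∀ z, H z = ∫ x : ℝ, ((h x : ℝ) : ℂ) * cexp (I * z * x) := by
    intro z; simp only [hHdef, weilMellin_half_add]
    exact integral_congr_ae (by filter_upwards [hhu] with x hx; rw [hx])
  have hGd : Differentiable ℂ G :=
    (differentiable_weilMellin_of_window hg1.integrableOn hg_ae).comp (by fun_prop)
  have hHd : Differentiable ℂ H :=
    (differentiable_weilMellin_of_window hu1.integrableOn hu_ae).comp (by fun_prop)
  set A : ℝ := max 1 (∫ y : ℝ, ‖g y‖) with hA
  have hGbound : ∀ z, ‖G z‖ ≤ A * Real.exp (t * ‖z‖) := by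
    intro z
    have h1 := norm_weilMellin_le_of_window hg1 hg_ae (1 / 2 + -(I * z))
    have h2 : ‖(1 / 2 + -(I * z) : ℂ) - 1 / 2‖ = ‖z‖ := by simp
    rw [h2] at h1
    calc ‖G z‖ ≤ Real.exp (t * ‖z‖) * ∫ y : ℝ, ‖g y‖ := h1
      _ ≤ Real.exp (t * ‖z‖) * A :=
          mul_le_mul_of_nonneg_left (le_max_right _ _) (Real.exp_pos _).le
      _ = A * Real.exp (t * ‖z‖) := mul_comm _ _
  -- the Fourier–Laplace identity `H = Θ·G` on `Im z > ½ + ω`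
  have hΘ : ∀ z : ℂ, 1 / 2 + ω < z.im → H z = suzukiTheta ω ν z * G z := by
    intro z hz
    obtain ⟨hKi, hKΘ⟩ := suzuki2021_prop41_fourier hω hν hνω hz
    have main := integral_kernelImage_mul_cexp (K := fun x ↦ ((K x : ℝ) : ℂ))
      (continuous_ofReal.comp hKc) hKi hKΘ hg1 hgt
    rw [hHint, hGint]
    simp_rw [hhC]
    exact main.2
  -- clearing the denominator: `H·ξ(½+ω−iz)^ν = ξ(½−ω−iz)^ν·G` on `ℂ`
  have hξne : ∀ z : ℂ, 1 / 2 + ω < z.im → riemannXi (1 / 2 + ω - I * z) ≠ 0 := by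
    intro z hz h0
    obtain ⟨-, -, h1⟩ := (riemannXi_eq_zero_iff_holds _).1 h0
    have : (1 / 2 + (ω : ℂ) - I * z).re = 1 / 2 + ω + z.im := by simp
    linarith
  set P : ℂ → ℂ := fun z ↦ H z * riemannXi (1 / 2 + ω - I * z) ^ ν with hP
  set Q : ℂ → ℂ := fun z ↦ riemannXi (1 / 2 - ω - I * z) ^ ν * G z with hQ
  have hPQ' : ∀ z : ℂ, 1 / 2 + ω < z.im → P z = Q z := by
    intro z hz
    have hE := pow_ne_zero ν (hξne z hz)
    simp only [hP, hQ]
    rw [hΘ z hz, suzukiTheta, div_pow, div_mul_eq_mul_div, div_mul_cancel₀ _ hE, mul_comm]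
  have hPd : Differentiable ℂ P := by
    simp only [hP]
    exact hHd.mul ((differentiable_riemannXi.comp (by fun_prop)).pow ν)
  have hQd : Differentiable ℂ Q := by
    simp only [hQ]
    exact ((differentiable_riemannXi.comp (by fun_prop)).pow ν).mul hGd
  have hPQ : P = Q := by
    refine AnalyticOnNhd.eq_of_eventuallyEq (hPd.differentiableOn.analyticOnNhd isOpen_univ)
      (hQd.differentiableOn.analyticOnNhd isOpen_univ) (z₀ := ((2 + ω : ℝ) : ℂ) * I) ?_
    have hopen : IsOpen {z : ℂ | 1 / 2 + ω < z.im} := isOpen_lt continuous_const Complex.continuous_im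
    have hmem : ((2 + ω : ℝ) : ℂ) * I ∈ {z : ℂ | 1 / 2 + ω < z.im} := by
      simp only [mem_setOf_eq]
      rw [show ((((2 + ω : ℝ) : ℂ) * I).im) = 2 + ω by simp]
      linarith
    filter_upwards [hopen.mem_nhds hmem] with z hz
    exact hPQ' z hz
  -- case split: either `G ≡ 0`, and then `f = 0` a.e. on the window, or Jensen is contradicted
  by_cases hG0 : ∀ z, G z = 0
  · -- `𝓕 g = 0`, hence `g = 0` a.e. (Plancherel on `L¹ ∩ L²`), hence `h ≡ 0`
    have hFg : 𝓕 g = 0 := by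
      funext w
      rw [Real.fourier_real_eq_integral_exp_smul, Pi.zero_apply]
      have h0 := hG0 (2 * π * w)
      rw [hGint] at h0
      rw [← h0]
      congr 1 with v
      rw [smul_eq_mul, mul_comm]
      congr 1
      push_cast
      ring_nf
    have hint0 : ∫ x : ℝ, ‖g x‖ ^ 2 = 0 := by
      rw [← Literature.Analysis.FunctionSpaces.integral_norm_sq_fourierIntegral_eq hg1 hg2, hFg]
      simp
    have hgsq : Integrable (fun x ↦ ‖g x‖ ^ 2) := (memLp_two_iff_integrable_sq_norm hg2.1).1 hg2
    have hgae : ∀ᵐ x : ℝ, g x = 0 := by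
      have := (integral_eq_zero_iff_of_nonneg (fun x ↦ by positivity) hgsq).1 hint0
      filter_upwards [this] with x hx
      simpa using hx
    have hall : ∀ x, h x = 0 := by
      intro x
      have hc := hhC x
      have h0 : ∫ y : ℝ, ((K (x + y) : ℝ) : ℂ) * g y = 0 :=
        integral_eq_zero_of_ae (by filter_upwards [hgae] with y hy; simp [hy])
      rw [h0] at hc
      exact_mod_cast hc
    exact Eventually.of_forall fun x ↦ by simpa using hall x
  · push Not at hG0
    obtain ⟨c, hc⟩ := hG0
    exfalso
    -- `G` has finite order everywhere
    have hGfin : ∀ z, analyticOrderAt G z ≠ ⊤ := by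
      intro z htop
      apply hc
      exact AnalyticOnNhd.eqOn_zero_of_preconnected_of_eventuallyEq_zero
        (hGd.differentiableOn.analyticOnNhd isOpen_univ) isPreconnected_univ (mem_univ z)
        (analyticOrderAt_eq_top.mp htop) (mem_univ c)
    -- the order count at every zero of `ζ`
    have hdef : ∀ ρ : ℂ,
        ((analyticOrderNatAt riemannXi ρ - analyticOrderNatAt riemannXi (ρ - 2 * (ω : ℂ)) : ℕ) : ℕ∞) ≤
          analyticOrderAt G (I * (ρ - 1 / 2 - ω)) :=
      deficiency_le_analyticOrderNatAt hν hHd hGd hGfin (fun z ↦ congrFun hPQ z)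
    -- the linear bound `N(T) ≤ L₁ T + L₀` for `T ≥ 0`
    set k : ℕ := ⌈1 / (2 * ω)⌉₊ with hk
    set L₁ : ℝ := (k + 1) * (2 * t) / Real.log 2 with hL₁
    set L₀ : ℝ := (k + 1) * (Real.log A + t * (‖c‖ + 2 * (ω + 1 + ‖c‖)) - Real.log ‖G c‖) /
      Real.log 2 with hL₀
    have hNle : ∀ T : ℝ, 0 ≤ T → (zetaZeroCount T : ℝ) ≤ L₁ * T + L₀ := by
      intro T hT
      set r : ℝ := T + ω + 1 + ‖c‖ with hr
      have hr0 : 0 < r := by rw [hr]; positivity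
      set B := (zetaZeroBox_finite 0 T).toFinset with hB
      set d : ℂ → ℕ := fun ρ ↦
        analyticOrderNatAt riemannXi ρ - analyticOrderNatAt riemannXi (ρ - 2 * (ω : ℂ)) with hd
      -- chain lemma
      have h1 : zetaZeroCount T ≤ (k + 1) * ∑ ρ ∈ B, d ρ := zetaZeroCount_le_mul_sum_deficiency hω T
      -- order count ⟹ divisor bound
      have h2 : ((∑ ρ ∈ B, d ρ : ℕ) : ℤ) ≤ ∑ᶠ w, MeromorphicOn.divisor G (closedBall c r) w := by
        refine sum_le_finsum_divisor hGd B (fun ρ ↦ I * (ρ - 1 / 2 - ω)) ?_ d ?_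
          (fun ρ _ ↦ hdef ρ) (fun ρ _ ↦ hGfin _)
        · intro x _ y _ hxy
          have := mul_left_cancel₀ I_ne_zero hxy
          simpa using this
        · intro ρ hρ
          have hρ' : ρ ∈ zetaZeroBox 0 T := (Set.Finite.mem_toFinset _).1 hρ
          obtain ⟨-, hre0, hre1, him0, himT⟩ := hρ'
          rw [mem_closedBall, dist_eq_norm]
          have hn : ‖I * (ρ - 1 / 2 - ω)‖ ≤ (1 / 2 + ω) + T := by
            rw [norm_mul, Complex.norm_I, one_mul]
            refine (Complex.norm_le_abs_re_add_abs_im _).trans (add_le_add ?_ ?_)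
            · have : (ρ - 1 / 2 - (ω : ℂ)).re = ρ.re - 1 / 2 - ω := by simp
              rw [this, abs_le]; constructor <;> linarith
            · have : (ρ - 1 / 2 - (ω : ℂ)).im = ρ.im := by simp
              rw [this, abs_of_pos him0]; exact himT
          calc ‖I * (ρ - 1 / 2 - ω) - c‖ ≤ ‖I * (ρ - 1 / 2 - ω)‖ + ‖c‖ := norm_sub_le _ _
            _ ≤ (1 / 2 + ω) + T + ‖c‖ := by linarith
            _ ≤ r := by rw [hr]; linarith
      -- Jensen
      have h3 := sum_divisor_le_of_expType hGd (le_max_left _ _) ht hGbound hc hr0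
      -- combine
      have h1' : (zetaZeroCount T : ℝ) ≤ (k + 1) * ((∑ ρ ∈ B, d ρ : ℕ) : ℝ) := by exact_mod_cast h1
      have h2' : ((∑ ρ ∈ B, d ρ : ℕ) : ℝ) ≤
          ((∑ᶠ w, MeromorphicOn.divisor G (closedBall c r) w : ℤ) : ℝ) := by
        exact_mod_cast h2
      have hk0 : (0 : ℝ) ≤ k + 1 := by positivity
      calc (zetaZeroCount T : ℝ) ≤ (k + 1) * ((∑ ρ ∈ B, d ρ : ℕ) : ℝ) := h1'
        _ ≤ (k + 1) * ((Real.log A + t * (‖c‖ + 2 * r) - Real.log ‖G c‖) / Real.log 2) :=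
            mul_le_mul_of_nonneg_left (h2'.trans h3) hk0
        _ = L₁ * T + L₀ := by rw [hL₁, hL₀, hr]; ring
    -- contradiction with `N(T)/T → ∞`
    have hev := (tendsto_zetaZeroCount_div_atTop.eventually_gt_atTop (L₁ + |L₀| + 1)).and
      (eventually_ge_atTop (1 : ℝ))
    obtain ⟨T, hT, hT1⟩ := hev.exists
    have hTpos : (0 : ℝ) < T := by linarith
    have hN := hNle T hTpos.le
    rw [lt_div_iff₀ hTpos] at hT
    have : L₀ ≤ (|L₀| + 1) * T := by
      calc L₀ ≤ |L₀| := le_abs_self _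
        _ ≤ (|L₀| + 1) * 1 := by linarith
        _ ≤ (|L₀| + 1) * T := mul_le_mul_of_nonneg_left hT1 (by positivity)
    nlinarith

end Literature.NumberTheory.LFunctions
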